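import Mathlib
import Summits.ValiantsHypothesis.ValiantsHypothesis.Theorems.FreeSubtorusSubtorusCovering
import Summits.ValiantsHypothesis.ValiantsHypothesis.Theorems.FreeSubtorusOrbitDimensionBoundStubAbsorbingSacrificeRelabelGeneral
import Summits.ValiantsHypothesis.ValiantsHypothesis.Theorems.FreeSubtorusOrbitDimensionBoundStubAbsorbingSacrificeLifts
import HarnessLib

/-!
# Route FreeSubtorus — crux `OrbitDimensionBound` (stmt-ValiantsHypothesis-16133), line `piecewise_covering`
# (a RUNG line: target `Piecewise.PiecewiseCovering`; the crux stays OPEN), registered stub 1 `stub_pieceSacrifice`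

`stub_pieceSacrifice` below is the registered statement `Stmt.stub_pieceSacrifice` of
`Cruxes/OrbitDimensionBound/Lines/piecewise_covering.lean` with the line-local vocabulary (`Admissible`,
`IsPiecewiseRepr` / `subtorus` from `Lines/PiecewiseLadder.lean`, `IsPiecewiseTorusRepr` / `fullTorus`) UNFOLDED
verbatim (the Cruxes files carry `sorry`s and are not importable from `Theorems/`); the skeleton closes its `sorry` by
`exact …Theorems.FreeSubtorusOrbitDimensionBound.stub_pieceSacrifice` (scratch-checked rc 0 against verbatim copies of the
five definitions).  Same convention as the landed stubs of the sister line `affine_multiple` (p567288 / p591335 / p570355).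

The proof is the floor's pair-sacrifice reduction (`Theorems/FreeSubtorusSubtorusCovering.lean`, `subtorusCovering_proof`
steps (1)–(5)) run PIECEWISE, using only landed pieces BY NAME: `stub_indepMatching`, `exists_perm_extend_embedding`,
`relabel_general` (general represented polynomial, p589861), `rename_prodMap_perPoly`, `stub_torusExtension`,
`stub_substPer`, `totalDegree_aeval_le_one`, `isEquivariantDetRepr_subst_const` (p4 g9's constant-aware lift transport,
p580173).  Merged desk RULING #92 (2026-08-28), `--supports stmt-ValiantsHypothesis-16133 --as helper`.

Honest framing: a registered stub (size M, bookkeeping) of a RUNG line inside one route; the line's load-bearing stub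
`stub_piecewiseTorusBound` ("piecewise Landsberg–Ressayre", L+), the crux `OrbitDimensionBound` (stmt-16133) and route
FreeSubtorus stay OPEN; census-neutral; nothing here bears on `VP ≠ VNP` (NOT proved).  No definitions, no named facts.
-/

set_option linter.dupNamespace false
set_option autoImplicit false

noncomputable section

open Matrix MvPolynomial Finset
open Literature.Computability.AlgebraicComplexity
open Summit.ValiantsHypothesis.ValiantsHypothesis.Theorems.FreeSubtorusSubtorusCovering
  (exists_perm_extend_embedding totalDegree_aeval_le_one stub_indepMatching stub_torusExtension stub_substPer
    rename_prodMap_perPoly)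
open Summit.ValiantsHypothesis.ValiantsHypothesis.Theorems.FreeSubtorusOrbitDimensionBound.AbsorbingSacrifice
  (relabel_general isEquivariantDetRepr_subst_const)

namespace Summit.ValiantsHypothesis.ValiantsHypothesis.Theorems.FreeSubtorusOrbitDimensionBound

/-- **Registered stub 1 of the line `piecewise_covering` — `Stmt.stub_pieceSacrifice`** (the line's
`Admissible`, `IsPiecewiseRepr`/`subtorus`, `IsPiecewiseTorusRepr`/`fullTorus` UNFOLDED verbatim; the skeleton
`Cruxes/OrbitDimensionBound/Lines/piecewise_covering.lean` closes its `sorry` by `exact` — checked against verbatim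
copies of the five definitions).  The floor's pair-sacrifice reduction (`Theorems/FreeSubtorusSubtorusCovering.lean`,
steps (1)–(5)) run PIECEWISE: a maximal independent matching in `Λ` (`stub_indepMatching`, `s ≤ r` pairs) either has
degenerate ranks (`n ≤ s + 2 ≤ r + 2`) or, after relabelling every piece by the same permutations (`relabel_general`,
general represented polynomial) and substituting `x_{(n'+j,n'+j)} = 1`, `0` elsewhere on the sacrificed lines in every
piece (`aeval g` is additive: `∑ aeval g P_i = aeval g per_{n'+s} = per_{n'}` by `stub_substPer`; lifts of the FULL
two-sided torus of the `n'` surviving lines by `stub_torusExtension` + `isEquivariantDetRepr_subst_const` applied to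
each piece), yields a piecewise FULL-torus decomposition of `per_{n'}` with the same `k` and `m`, `n' ≥ 3`,
`n - n' = s ≤ r`.

Honest framing: a registered stub (size M, bookkeeping) of a RUNG line inside one route; the line's load-bearing
stub `stub_piecewiseTorusBound` ("piecewise Landsberg–Ressayre"), the crux `OrbitDimensionBound` (stmt-16133) and
route FreeSubtorus stay OPEN; census-neutral; nothing here bears on `VP ≠ VNP` (NOT proved).  No definitions, no
named facts. [cite: LandsbergRessayre2017, §6] -/
theorem stub_pieceSacrifice :
    ∀ (n k m r : ℕ) (Λ : Fin r → (Fin n ⊕ Fin n) → ℤ) (P : Fin k → MvPolynomial (Fin n × Fin n) ℂ)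
      (B : Fin k → Matrix (Fin m) (Fin m) (MvPolynomial (Fin n × Fin n) ℂ)),
      3 ≤ n → (∀ i, (∑ k, Λ i (Sum.inl k)) = 0 ∧ (∑ l, Λ i (Sum.inr l)) = 0) →
      ((∑ i, P i) = perPoly (Fin n) ℂ ∧
        ∀ i, IsEquivariantDetRepr (Subgroup.closure {γ : Matrix.GeneralLinearGroup (Fin n × Fin n) ℂ |
          ∃ d e : Fin n → ℂˣ, (∀ i, (∏ k, (d k) ^ (Λ i (Sum.inl k))) * (∏ l, (e l) ^ (Λ i (Sum.inr l))) = 1) ∧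
            (γ : Matrix (Fin n × Fin n) (Fin n × Fin n) ℂ) =
              Matrix.diagonal (fun p => (d p.1 : ℂ) * (e p.2 : ℂ))}) (P i) (B i)) →
      n ≤ r + 2 ∨
        ∃ (s n' : ℕ), s ≤ r ∧ n = n' + s ∧ 3 ≤ n' ∧
          ∃ (P' : Fin k → MvPolynomial (Fin n' × Fin n') ℂ)
            (B' : Fin k → Matrix (Fin m) (Fin m) (MvPolynomial (Fin n' × Fin n') ℂ)),
            (∑ i, P' i) = perPoly (Fin n') ℂ ∧
              ∀ i, IsEquivariantDetRepr (Subgroup.closure {γ : GL (Fin n' × Fin n') ℂ | ∃ d e : Fin n' → ℂ,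
                (γ : Matrix (Fin n' × Fin n') (Fin n' × Fin n') ℂ) = Matrix.diagonal (fun p => d p.1 * e p.2)})
                (P' i) (B' i) := by
  intro n k m r Λ P B hn hΛ hPB
  classical
  obtain ⟨hsum, hB⟩ := hPB
  -- (1) the matching
  obtain ⟨s, ι, κ, hsr, hcase⟩ := stub_indepMatching n r Λ (fun i => (hΛ i).1)
  by_cases hdeg : n ≤ s + 2
  · left; omega
  right
  rcases hcase with h | ⟨N, hN, hrow, hcol⟩
  · exact absurd h hdeg
  obtain ⟨n', rfl⟩ : ∃ n', n = n' + s := ⟨n - s, by omega⟩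
  have hn' : 3 ≤ n' := by omega
  refine ⟨s, n', hsr, rfl, hn', ?_⟩
  -- (2) relabel every piece: sacrificed pairs to the last `s` diagonal positions
  obtain ⟨ρ, hρ⟩ := exists_perm_extend_embedding ι (Fin.natAddEmb n')
  obtain ⟨κ₀, hκ₀⟩ := exists_perm_extend_embedding κ (Fin.natAddEmb n')
  have hρ' : ∀ j, ρ.symm (Fin.natAdd n' j) = ι j := fun j => by
    rw [Equiv.symm_apply_eq]; exact (hρ j).symm
  have hκ₀' : ∀ j, κ₀.symm (Fin.natAdd n' j) = κ j := fun j => by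
    rw [Equiv.symm_apply_eq]; exact (hκ₀ j).symm
  set Λ' : Fin r → (Fin (n' + s) ⊕ Fin (n' + s)) → ℤ := fun i =>
    Sum.elim (fun k => Λ i (Sum.inl (ρ.symm k))) (fun l => Λ i (Sum.inr (κ₀.symm l))) with hΛ'
  set P₁ : Fin k → MvPolynomial (Fin (n' + s) × Fin (n' + s)) ℂ := fun i =>
    MvPolynomial.rename (Prod.map ρ κ₀) (P i) with hP₁def
  set B₁ : Fin k → Matrix (Fin m) (Fin m) (MvPolynomial (Fin (n' + s) × Fin (n' + s)) ℂ) := fun i =>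
    (B i).map (MvPolynomial.rename (Prod.map ρ κ₀)) with hB₁def
  have hB₁ : ∀ i, IsEquivariantDetRepr (Subgroup.closure
      {γ : Matrix.GeneralLinearGroup (Fin (n' + s) × Fin (n' + s)) ℂ |
        ∃ d e : Fin (n' + s) → ℂˣ,
          (∀ i, (∏ k, (d k) ^ (Λ' i (Sum.inl k))) * (∏ l, (e l) ^ (Λ' i (Sum.inr l))) = 1) ∧
          (γ : Matrix (Fin (n' + s) × Fin (n' + s)) (Fin (n' + s) × Fin (n' + s)) ℂ) =
            Matrix.diagonal (fun p => (d p.1 : ℂ) * (e p.2 : ℂ))}) (P₁ i) (B₁ i) :=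
    fun i => relabel_general (n' + s) r m Λ (P i) (B i) ρ κ₀ (hB i)
  have hsum₁ : (∑ i, P₁ i) = perPoly (Fin (n' + s)) ℂ := by
    simp only [hP₁def, ← map_sum, hsum]
    exact rename_prodMap_perPoly ℂ ρ κ₀
  -- (3) the integer relations, relabelled
  have hrow' : ∀ k : Fin n', ∃ a : Fin s → ℤ, ∀ i,
      (N : ℤ) * Λ' i (Sum.inl (Fin.castAdd s k)) =
        ∑ j, a j * (Λ' i (Sum.inl (Fin.natAdd n' j)) - Λ' i (Sum.inr (Fin.natAdd n' j))) := by
    intro k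
    obtain ⟨a, ha⟩ := hrow (ρ.symm (Fin.castAdd s k))
    refine ⟨a, fun i => ?_⟩
    simp only [hΛ', Sum.elim_inl, Sum.elim_inr, hρ', hκ₀']
    exact ha i
  have hcol' : ∀ l : Fin n', ∃ a : Fin s → ℤ, ∀ i,
      (N : ℤ) * Λ' i (Sum.inr (Fin.castAdd s l)) =
        ∑ j, a j * (Λ' i (Sum.inl (Fin.natAdd n' j)) - Λ' i (Sum.inr (Fin.natAdd n' j))) := by
    intro l
    obtain ⟨a, ha⟩ := hcol (κ₀.symm (Fin.castAdd s l))
    refine ⟨a, fun i => ?_⟩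
    simp only [hΛ', Sum.elim_inl, Sum.elim_inr, hρ', hκ₀']
    exact ha i
  -- (4) the extension property of the free torus (roots of `N`-th powers exist in `ℂ`)
  have hext : ∀ d' e' : Fin n' → ℂ, (∀ k, d' k ≠ 0) → (∀ l, e' l ≠ 0) →
      ∃ d e : Fin (n' + s) → ℂˣ,
        (∀ i, (∏ k, (d k) ^ (Λ' i (Sum.inl k))) * (∏ l, (e l) ^ (Λ' i (Sum.inr l))) = 1) ∧
        (∀ k l, (d (Fin.castAdd s k) : ℂ) * (e (Fin.castAdd s l) : ℂ) = d' k * e' l) ∧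
        (∀ j, (d (Fin.natAdd n' j) : ℂ) * (e (Fin.natAdd n' j) : ℂ) = 1) := by
    intro d' e' hd' he'
    choose dr hdr using fun k => IsAlgClosed.exists_pow_nat_eq (d' k) hN
    choose er her using fun l => IsAlgClosed.exists_pow_nat_eq (e' l) hN
    have hdr0 : ∀ k, dr k ≠ 0 := fun k h0 => hd' k (by rw [← hdr k, h0, zero_pow hN.ne'])
    have her0 : ∀ l, er l ≠ 0 := fun l h0 => he' l (by rw [← her l, h0, zero_pow hN.ne'])
    obtain ⟨d, e, hrel, hd, he, hde⟩ := stub_torusExtension n' s r Λ' N hN hrow' hcol'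
      (fun k => Units.mk0 (dr k) (hdr0 k)) (fun l => Units.mk0 (er l) (her0 l))
    refine ⟨d, e, hrel, fun k l => ?_, fun j => ?_⟩
    · rw [hd k, he l, Units.val_pow_eq_pow_val, Units.val_pow_eq_pow_val, Units.val_mk0,
        Units.val_mk0, hdr k, her l]
    · rw [← Units.val_mul, hde j, Units.val_one]
  -- (5) the substitution, applied to every piece
  let g : Fin (n' + s) × Fin (n' + s) → MvPolynomial (Fin n' × Fin n') ℂ := fun p =>
    Fin.addCases (motive := fun _ => MvPolynomial (Fin n' × Fin n') ℂ)
      (fun k => Fin.addCases (motive := fun _ => MvPolynomial (Fin n' × Fin n') ℂ)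
        (fun l => X (k, l)) (fun _ => 0) p.2)
      (fun j => Fin.addCases (motive := fun _ => MvPolynomial (Fin n' × Fin n') ℂ)
        (fun _ => 0) (fun j' => if j = j' then 1 else 0) p.2)
      p.1
  have hg₁ : ∀ k l, g (Fin.castAdd s k, Fin.castAdd s l) = X (k, l) := fun k l => by
    simp [g]
  have hg₂ : ∀ k j, g (Fin.castAdd s k, Fin.natAdd n' j) = 0 := fun k j => by
    simp [g]
  have hg₃ : ∀ j l, g (Fin.natAdd n' j, Fin.castAdd s l) = 0 := fun j l => by
    simp [g]
  have hg₄ : ∀ j j', g (Fin.natAdd n' j, Fin.natAdd n' j') = if j = j' then 1 else 0 :=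
    fun j j' => by simp [g]
  have hg₂' : ∀ k j, g (Fin.castAdd s k, Fin.natAdd n' j) = C ((fun _ _ => (0 : ℂ)) k j) := fun k j => by
    rw [hg₂, map_zero]
  have hg₃' : ∀ j l, g (Fin.natAdd n' j, Fin.castAdd s l) = C ((fun _ _ => (0 : ℂ)) j l) := fun j l => by
    rw [hg₃, map_zero]
  have hg₄' : ∀ j j', g (Fin.natAdd n' j, Fin.natAdd n' j') =
      C ((fun j j' => if j = j' then (1 : ℂ) else 0) j j') := fun j j' => by
    rw [hg₄]; by_cases h : j = j' <;> simp [h]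
  have hgdeg : ∀ p, (g p).totalDegree ≤ 1 := by
    rintro ⟨a, b⟩
    induction a using Fin.addCases <;> induction b using Fin.addCases
    · rw [hg₁]; exact (totalDegree_X _).le
    · rw [hg₂]; simp
    · rw [hg₃]; simp
    · rw [hg₄]; split_ifs <;> simp
  set P₂ : Fin k → MvPolynomial (Fin n' × Fin n') ℂ := fun i => MvPolynomial.aeval g (P₁ i) with hP₂def
  set B₂ : Fin k → Matrix (Fin m) (Fin m) (MvPolynomial (Fin n' × Fin n') ℂ) := fun i =>
    (B₁ i).map (MvPolynomial.aeval g) with hB₂def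
  refine ⟨P₂, B₂, ?_, fun i => ?_⟩
  · -- the pieces still sum to the permanent
    simp only [hP₂def, ← map_sum, hsum₁]
    exact stub_substPer n' s g hg₁ hg₂ hg₃ hg₄
  · -- every piece: affine, determinant, and lifts of the full torus of the surviving lines
    have haff₂ : ∀ a b, (B₂ i a b).totalDegree ≤ 1 := fun a b => by
      simp only [hB₂def, Matrix.map_apply]
      exact totalDegree_aeval_le_one g hgdeg _ ((hB₁ i).1.1 a b)
    have hdet₂ : (B₂ i).det = P₂ i := by
      simp only [hB₂def, hP₂def]
      rw [← AlgHom.mapMatrix_apply, ← AlgHom.map_det, (hB₁ i).1.2]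
    refine isEquivariantDetRepr_subst_const n' s r m Λ' (P₁ i) (P₂ i) (B₁ i) g (fun _ _ => 0) (fun _ _ => 0)
      (fun j j' => if j = j' then (1 : ℂ) else 0) hg₁ hg₂' hg₃' hg₄' (hB₁ i) ⟨haff₂, hdet₂⟩ _ ?_
    rintro γ' ⟨d', e', hγ'⟩
    -- the generator is invertible, so `d' k ≠ 0`, `e' l ≠ 0`
    have hne : ∀ p : Fin n' × Fin n', d' p.1 * e' p.2 ≠ 0 := by
      have hdet : (γ' : Matrix (Fin n' × Fin n') (Fin n' × Fin n') ℂ).det ≠ 0 :=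
        ((Matrix.isUnit_iff_isUnit_det _).1 (Units.isUnit γ')).ne_zero
      rw [hγ', Matrix.det_diagonal] at hdet
      exact fun p => (Finset.prod_ne_zero_iff.1 hdet) p (Finset.mem_univ p)
    have i0 : Fin n' := ⟨0, by omega⟩
    have hd' : ∀ k, d' k ≠ 0 := fun k h => hne (k, i0) (by rw [h, zero_mul])
    have he' : ∀ l, e' l ≠ 0 := fun l h => hne (i0, l) (by rw [h, mul_zero])
    obtain ⟨d, e, hrel, hfree, hdiag⟩ := hext d' e' hd' he'
    refine ⟨d', e', d, e, hγ', hrel, hfree, fun k j h => absurd rfl h, fun j l h => absurd rfl h,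
      fun j j' h => ?_⟩
    by_cases hjj : j = j'
    · subst hjj; exact hdiag j
    · exact absurd (if_neg hjj) h

end Summit.ValiantsHypothesis.ValiantsHypothesis.Theorems.FreeSubtorusOrbitDimensionBound

end
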